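import Summits.ResolutionOfSingularities.ResolutionOfSingularities.Theses.TeissierJung
import Summits.ResolutionOfSingularities.ResolutionOfSingularities.Theorems.TeissierReduction.Negative.TeissierQuotientF2Point
import Literature.AlgebraicGeometry.Resolution.ProjectiveSpaceRegular
import Literature.AlgebraicGeometry.Motives.VarietiesProjectiveSpaceProofs
import Literature.AlgebraicGeometry.Motives.VarietiesProperProofs

/-!
# `TeissierReduction` (crux stmt-ResolutionOfSingularities-17085, route `TeissierJung`):
# the hypothesis `IsAlgClosed k` is load-bearing — weakened to `PerfectField k` the statement is
# FALSE (negative-side support, refuter crux-disprover seat, gen 2; this file does NOT refute the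
# crux)

The crux asks, over an ALGEBRAICALLY CLOSED field `k` of characteristic `p`, for a proper
birational `ρ : X' → H` onto every integral projective hypersurface `H` with `TF X'` (every
analytic branch at every closed point a Teissier quotient over `k⟦x⟧`, coefficients in `k`). This
file proves that the same text with `[IsAlgClosed k]` replaced by `[PerfectField k]` (everything
else byte-identical) is false — so the descent items of the route (`DescentAlgclosedToPerfect`,
`DescentPerfectToAll`) cannot be bypassed by proving the crux over perfect fields, and any proof
of the crux must use that closed points of `X'` are `k`-rational.

## The argument (witness `p = 2`, `k = 𝔽₂`, `m = 1`, `H = ℙ¹_{𝔽₂}`, `ι' = 𝟙`)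

* `Negative/TeissierQuotientF2Point.lean`: at every closed point `x` of a Teissier-presented
  scheme over `𝔽₂` there is a ring homomorphism `𝒪_{X',x} → 𝔽₂`
  (`exists_ringHom_stalk_of_teissierPresented`); a ring with an element `w` such that `w` and
  `w − 1` are units has none (`false_of_ringHom_zmod2`).
* `exists_closed_point_units` — a dense open `U ⊆ ℙ¹_K` contains a CLOSED point `t` with such a
  `w ∈ 𝒪_{ℙ¹,t}`: in the chart `D₊(x₀) ≅ Spec K[y]` (`ProjectiveSpace.chartCover`,
  `chartAlgEquiv`) take a maximal ideal avoiding `f · y · (y − 1)` for a basic open `D(f) ⊆ U`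
  (`K[y]` is a Jacobson domain); `t` is closed in the Jacobson space `ℙ¹_K`; `w` is the germ of
  `y`, moved along the invertible stalk map of the open immersion. For `K = 𝔽₂`, `t` is a closed
  point of degree `≥ 2`.
* `teissierReduction_false_over_perfectField` — `H = ℙ¹_{𝔽₂}` is an integral hypersurface of
  itself (`ι' = 𝟙`, kernel `⊥` principal); a proper birational `ρ : X' → ℙ¹` is an isomorphism
  over a dense open `U`; the closed point of `X'` over `t ∈ U` inherits the units `w, w − 1`
  (`exists_closed_point_of_isIso_restrict`), so its local ring has no map to `𝔽₂` — but `TF X'`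
  provides one. The minimal repair is the typed hypothesis `IsAlgClosed k` itself (equivalently:
  a presentation allowing residue-field extensions of `k`).
-/

noncomputable section

set_option linter.dupNamespace false

namespace Summit.ResolutionOfSingularities.ResolutionOfSingularities.Theorems.TeissierReduction.Negative

open CategoryTheory AlgebraicGeometry IsLocalRing Topology MvPolynomial
open Literature.AlgebraicGeometry.Resolution

universe u

/-! ## §3 The projective line over a field: non-rational closed points in every dense open -/




/-- A dense open `U ⊆ ℙ¹_K` contains a CLOSED point `t` whose local ring has an element `w` with
`w` and `w − 1` both units — a closed point of the chart `D₊(x₀) ≅ Spec K[y]` other than `y = 0`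
and `y = 1` (for `K = 𝔽₂`: a closed point of degree `≥ 2`). Ingredients: the chart is a Jacobson
domain, so some maximal ideal avoids `f · y · (y − 1)` for a basic open `D(f) ⊆ U`; closed points
of the chart are closed in the Jacobson space `ℙ¹_K`; `w` is the germ of `y`, transported along
the invertible stalk map of the open immersion. [folklore] -/
theorem exists_closed_point_units (K : Type) [Field K]
    (U : (Literature.AlgebraicGeometry.Motives.projectiveSpace 1 K).left.Opens)
    (hU : Dense (U : Set (Literature.AlgebraicGeometry.Motives.projectiveSpace 1 K).left)) :
    ∃ t : (Literature.AlgebraicGeometry.Motives.projectiveSpace 1 K).left, t ∈ U ∧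
      IsClosed ({t} : Set _) ∧
      ∃ w : (Literature.AlgebraicGeometry.Motives.projectiveSpace 1 K).left.presheaf.stalk t,
        IsUnit w ∧ IsUnit (w - 1) := by
  classical
  -- the grading of `K[x₀, x₁]` and the `K`-algebra structure of the chart ring (Mathlib and
  -- `Motives/BaseChangeProofs` keep both non-global; they are needed to name `chartAlgEquiv`)
  letI igr : GradedAlgebra (MvPolynomial.homogeneousSubmodule (Fin (1 + 1)) K) :=
    MvPolynomial.gradedAlgebra
  letI ialg : Algebra K (HomogeneousLocalization.Away
      (MvPolynomial.homogeneousSubmodule (Fin (1 + 1)) K) (MvPolynomial.X 0)) :=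
    Literature.AlgebraicGeometry.Motives.ProjBaseChange.algebraBase _ _
  let R := MvPolynomial (Fin 1) K
  let j : Spec (.of R) ⟶ (Literature.AlgebraicGeometry.Motives.projectiveSpace 1 K).left :=
    Spec.map (Literature.AlgebraicGeometry.Motives.ProjectiveSpace.chartAlgEquiv K
      (0 : Fin 2)).toRingEquiv.toCommRingCatIso.hom ≫
      (Literature.AlgebraicGeometry.Motives.ProjectiveSpace.chartCover 1 K).f (0 : Fin 2)
  haveI : IsOpenImmersion j :=
    @IsOpenImmersion.comp _ _ _ _ _ (IsOpenImmersion.of_isIso _)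
      ((Literature.AlgebraicGeometry.Motives.ProjectiveSpace.chartCover 1 K).map_prop (0 : Fin 2))
  haveI : JacobsonSpace (Literature.AlgebraicGeometry.Motives.projectiveSpace 1 K).left := by
    haveI := Literature.AlgebraicGeometry.Motives.isProper_projectiveSpace 1 K
    exact LocallyOfFiniteType.jacobsonSpace
      (Literature.AlgebraicGeometry.Motives.projectiveSpace 1 K).hom
  -- a point of the chart inside `U`
  let y0 : Spec (.of R) := (⟨⊥, Ideal.isPrime_bot⟩ : PrimeSpectrum R)
  obtain ⟨_, ⟨y, rfl⟩, hyU⟩ := hU.inter_open_nonempty (Set.range j.base)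
    j.isOpenEmbedding.isOpen_range ⟨_, ⟨y0, rfl⟩⟩
  have hyU' : y ∈ j ⁻¹ᵁ U := hyU
  obtain ⟨_, ⟨f, rfl⟩, hyf, hfU⟩ :=
    (PrimeSpectrum.isTopologicalBasis_basic_opens (R := R)).exists_subset_of_mem_open hyU'
      (j ⁻¹ᵁ U).isOpen
  have hf0 : f ≠ 0 := by
    rintro rfl
    exact (PrimeSpectrum.mem_basicOpen _ _).1 hyf (zero_mem _)
  have hX0 : (MvPolynomial.X 0 : R) ≠ 0 := MvPolynomial.X_ne_zero _
  have hX1 : (MvPolynomial.X 0 - 1 : R) ≠ 0 := by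
    intro h
    have := congrArg (MvPolynomial.eval fun _ => (0 : K)) h
    simp at this
  have hF : f * MvPolynomial.X 0 * (MvPolynomial.X 0 - 1) ≠ 0 :=
    mul_ne_zero (mul_ne_zero hf0 hX0) hX1
  obtain ⟨M, hM, hFM⟩ := exists_isMaximal_not_mem hF
  have hfM : f ∉ M := fun h => hFM (M.mul_mem_right _ (M.mul_mem_right _ h))
  have hXM : (MvPolynomial.X 0 : R) ∉ M := fun h => hFM (M.mul_mem_right _ (M.mul_mem_left _ h))
  have hX1M : (MvPolynomial.X 0 - 1 : R) ∉ M := fun h => hFM (M.mul_mem_left _ h)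
  let t' : Spec (.of R) := (⟨M, hM.isPrime⟩ : PrimeSpectrum R)
  have ht'U : j.base t' ∈ U := hfU ((PrimeSpectrum.mem_basicOpen _ _).2 hfM)
  have ht'c : IsClosed ({t'} : Set (Spec (.of R))) :=
    (PrimeSpectrum.isClosed_singleton_iff_isMaximal _).2 hM
  have htc : IsClosed ({j.base t'} :
      Set (Literature.AlgebraicGeometry.Motives.projectiveSpace 1 K).left) := by
    have hpre := j.isOpenEmbedding.preimage_closedPoints
    have ht'cp : t' ∈ closedPoints (Spec (.of R)) := ht'c
    rw [← hpre] at ht'cp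
    exact ht'cp
  -- units in the stalk of the chart
  let s : Γ(Spec (.of R), ⊤) := (Scheme.ΓSpecIso (.of R)).inv (MvPolynomial.X 0)
  have hunit : IsUnit ((Spec (.of R)).presheaf.germ ⊤ t' trivial s) := by
    rw [← Scheme.mem_basicOpen]
    show t' ∈ (Spec (.of R)).basicOpen ((Scheme.ΓSpecIso (.of R)).inv (MvPolynomial.X 0))
    rw [basicOpen_eq_of_affine]
    exact (PrimeSpectrum.mem_basicOpen _ _).2 hXM
  have hunit1 : IsUnit ((Spec (.of R)).presheaf.germ ⊤ t' trivial s - 1) := by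
    have : (Spec (.of R)).presheaf.germ ⊤ t' trivial s - 1 =
        (Spec (.of R)).presheaf.germ ⊤ t' trivial
          ((Scheme.ΓSpecIso (.of R)).inv (MvPolynomial.X 0 - 1)) := by
      rw [map_sub, map_one, map_sub, map_one]
    rw [this, ← Scheme.mem_basicOpen]
    show t' ∈ (Spec (.of R)).basicOpen ((Scheme.ΓSpecIso (.of R)).inv (MvPolynomial.X 0 - 1))
    rw [basicOpen_eq_of_affine]
    exact (PrimeSpectrum.mem_basicOpen _ _).2 hX1M
  -- transport to `ℙ¹` along the (invertible) stalk map of the open immersion `j`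
  let e := asIso (j.stalkMap t')
  refine ⟨j.base t', ht'U, htc, e.inv.hom ((Spec (.of R)).presheaf.germ ⊤ t' trivial s),
    hunit.map _, ?_⟩
  rw [← map_one e.inv.hom, ← map_sub]
  exact hunit1.map _


/-! ## §4 The load-bearing lemma -/

/-- **`IsAlgClosed k` is load-bearing in `TeissierReduction`.** The crux with `[IsAlgClosed k]`
weakened to `[PerfectField k]` (verbatim otherwise) fails: at `p = 2`, `k = 𝔽₂` (perfect),
`m = 1`, `H = ℙ¹_{𝔽₂}` with `ι' = 𝟙` (a closed immersion; its kernel `⊥` is principal on every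
affine open; `ℙ¹` is integral), any proper birational `ρ : X' → ℙ¹` is an isomorphism over a dense
open `U`, which contains a closed point of degree `≥ 2` (`exists_closed_point_units`); the closed
point of `X'` over it carries units `w, w − 1` in its local ring, so that local ring has no
homomorphism to `𝔽₂` (`false_of_ringHom_zmod2`) — whereas `TF X'` would give one
(`exists_ringHom_stalk_of_teissierPresented`, via `teissierPresented_iff`). [folklore] -/
theorem teissierReduction_false_over_perfectField :
    ¬ (∀ p : ℕ, p.Prime → ∀ (k : Type) [Field k] [CharP k p] [PerfectField k], let TF : AlgebraicGeometry.Scheme.{0} → Prop := fun X' => (∃ (S : AlgebraicGeometry.Scheme.{0}) (g : S ⟶ AlgebraicGeometry.Spec (.of k)) (π : X' ⟶ S), AlgebraicGeometry.IsSeparated g ∧ AlgebraicGeometry.LocallyOfFiniteType g ∧ AlgebraicGeometry.QuasiCompact g ∧ AlgebraicGeometry.IsIntegral S ∧ Literature.AlgebraicGeometry.Resolution.Scheme.IsRegular S ∧ AlgebraicGeometry.IsIntegral X' ∧ AlgebraicGeometry.IsFinite π ∧ ∀ x : X', IsClosed ({x} : Set X') → ∀ P ∈ minimalPrimes (AdicCompletion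 (IsLocalRing.maximalIdeal (X'.presheaf.stalk x)) (X'.presheaf.stalk x)), ∃ (d g : ℕ) (n : Fin g → ℕ) (v : Fin g → (Fin d → ℚ)) (c : Fin g → k) (A : Fin g → (Fin d →₀ ℕ)) (mu : Fin g → (Fin g →₀ ℕ)) (h : Fin g → MvPolynomial (Fin g) (MvPowerSeries (Fin d) k)) (φ : AdicCompletion (IsLocalRing.maximalIdeal (S.presheaf.stalk (π.base x))) (S.presheaf.stalk (π.base x)) ≃+* MvPowerSeries (Fin d) k), let W : (Fin d →₀ ℕ) → (Fin g →₀ ℕ) → (Fin d → ℚ) := fun a e j => (a j : ℚ) + ∑ i : Fin g, (e i : ℚ) * v i j; let core : Fin g → MvPolynomial (Fin g) (MvPowerSeries (Fin d) k) := fun i => MvPolynomial.X i ^ (n i) - MvPolynomial.C (MvPowerSeries.monomial (A i) (c i)) * MvPolynomial.monomial (mu i) 1 + h i; let E : Fin g → MvPolynomial (Fin g) (MvPowerSeries (Fin d) k) := fun i => if hi : i.val + 1 < g then MvPolynomial.X ⟨i.val + 1, hi⟩ - core i else core i; let B : Fin g → MvPolynomial (Fin d ⊕ Fin g) k := fun i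 => MvPolynomial.X (Sum.inr i) ^ (n i) - MvPolynomial.C (c i) * MvPolynomial.monomial ((A i).sumElim (mu i)) 1; ∃ ψ : (AdicCompletion (IsLocalRing.maximalIdeal (X'.presheaf.stalk x)) (X'.presheaf.stalk x) ⧸ P) ≃+* (MvPolynomial (Fin g) (MvPowerSeries (Fin d) k) ⧸ Ideal.span (Set.range E)), (∀ i, 2 ≤ n i) ∧ (∀ i, c i ≠ 0) ∧ (∀ i j, 0 ≤ v i j) ∧ (∀ i (j : Fin g), i.val ≤ j.val → mu i j = 0) ∧ (∀ i, n i • v i = W (A i) (mu i)) ∧ (∀ (i : Fin g) (hi : i.val + 1 < g), n i • v i ≤ v ⟨i.val + 1, hi⟩ ∧ n i • v i ≠ v ⟨i.val + 1, hi⟩) ∧ (∀ i, ∀ e ∈ (h i).support, (∀ j : Fin g, i.val + 1 < j.val → e j = 0) ∧ ∀ a : Fin d →₀ ℕ, MvPowerSeries.coeff a ((h i).coeff e) ≠ 0 → n i • v i ≤ W a e ∧ n i • v i ≠ W a e) ∧ (Ideal.span (Set.range B)).IsPrime ∧ (∀ a : S.presheaf.stalk (π.base x), ψ (Ideal.Quotient.mk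 P (algebraMap _ _ ((π.stalkMap x).hom a))) = Ideal.Quotient.mk _ (MvPolynomial.C (φ (algebraMap _ _ a))))); ∀ (m : ℕ) (H : AlgebraicGeometry.Scheme.{0}) (ι' : H ⟶ (Literature.AlgebraicGeometry.Motives.projectiveSpace m k).left), AlgebraicGeometry.IsClosedImmersion ι' → AlgebraicGeometry.IsIntegral H → (∀ y : (Literature.AlgebraicGeometry.Motives.projectiveSpace m k).left, ∃ U : (Literature.AlgebraicGeometry.Motives.projectiveSpace m k).left.affineOpens, y ∈ (U : (Literature.AlgebraicGeometry.Motives.projectiveSpace m k).left.Opens) ∧ (ι'.ker.ideal U).IsPrincipal) → ∃ (X' : AlgebraicGeometry.Scheme.{0}) (ρ : X' ⟶ H), AlgebraicGeometry.IsProper ρ ∧ Literature.AlgebraicGeometry.Resolution.IsBirational ρ ∧ TF X') := by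
  intro h
  haveI : IsIntegral (Literature.AlgebraicGeometry.Motives.projectiveSpace 1 (ZMod 2)).left :=
    isIntegral_projectiveSpace 1 (ZMod 2)
  have hprinc : ∀ y : (Literature.AlgebraicGeometry.Motives.projectiveSpace 1 (ZMod 2)).left,
      ∃ U : (Literature.AlgebraicGeometry.Motives.projectiveSpace 1 (ZMod 2)).left.affineOpens,
        y ∈ (U : (Literature.AlgebraicGeometry.Motives.projectiveSpace 1 (ZMod 2)).left.Opens) ∧
        ((𝟙 (Literature.AlgebraicGeometry.Motives.projectiveSpace 1 (ZMod 2)).left :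
          (Literature.AlgebraicGeometry.Motives.projectiveSpace 1 (ZMod 2)).left ⟶ _).ker.ideal
            U).IsPrincipal := by
    intro y
    obtain ⟨_, ⟨V, hV, rfl⟩, hyV, -⟩ :=
      (Literature.AlgebraicGeometry.Motives.projectiveSpace 1
        (ZMod 2)).left.isBasis_affineOpens.exists_subset_of_mem_open (Set.mem_univ y) isOpen_univ
    refine ⟨⟨V, hV⟩, hyV, ?_⟩
    rw [Scheme.Hom.ker_eq_bot_of_isIso]
    simp only [Scheme.IdealSheafData.ideal_bot, Pi.bot_apply]
    exact bot_isPrincipal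
  obtain ⟨X', ρ, -, ⟨U, hU, -, hiso⟩, hTF⟩ := h 2 Nat.prime_two (ZMod 2) 1
    (Literature.AlgebraicGeometry.Motives.projectiveSpace 1 (ZMod 2)).left (𝟙 _) inferInstance
    inferInstance hprinc
  have hTP : TeissierPresented (ZMod 2) X' := (teissierPresented_iff (ZMod 2) X').2 hTF
  obtain ⟨t, htU, htc, hw⟩ := exists_closed_point_units (ZMod 2) U hU
  haveI := hiso
  obtain ⟨x, hxc, w, hw, hw1⟩ := exists_closed_point_of_isIso_restrict ρ U t htU htc hw
  obtain ⟨χ⟩ := exists_ringHom_stalk_of_teissierPresented hTP x hxc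
  exact false_of_ringHom_zmod2 χ hw hw1

end Summit.ResolutionOfSingularities.ResolutionOfSingularities.Theorems.TeissierReduction.Negative

end
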